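import Summits.ABC.IUTFork.Repair.CandInternal2RealLabelsLicenceBall
import Summits.ABC.IUTFork.Repair.CandInternal2RealLabelsLicenceGenuineK
import Summits.ABC.IUTFork.Cor312LicenceTameBoundaryGenuineK
import HarnessLib

/-!
# IUT REPAIR branch → R-H (D-0079 «local-height I06⋆»), part 4: the REAL I06⋆ cells JOINED to the (xi-f) licence and to branch C's S_H
# antecedent AT THE GENUINE `K`-LEVEL DATUM over TORSION-FREE SUB-WILD bad fibres (R-W strata U1 ∪ U1½: `p` odd, `e_p ≤ p − 1`, `ζ_p ∉ K_w`)

PROOF-ONLY k2-engine file (D-0012: 0 definitions, 0 `Prop` facts, no instance, no notation) of the abc-iut cell, rung LADDER-ABC:A2.RESCUE.H;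
seat abc-iut-w5-d068 gen 6 (k2 hand; claim «RH-BALL-JOIN», part 4 = the genuine-datum reading of part 3, as part 2 reads part 1). TAKES NO
SIDE on [IUTchIII] Cor. 3.12 or on any author; RP-I06⋆ is abc-iut-rp-d2's CANDIDATE READING (a bound hypothesis, never asserted); typed ≠
proved; instantiated ≠ endorsed; refuted-as-typed ≠ refuted-in-print.
INPUTS, BY NAME (nothing re-typed): part 3 `CandInternal2RealLabelsLicenceBall` (p457373: ball-shaped places, `mem_pow_smul_logShell_iff_int_of_ball`);
part 2 `CandInternal2RealLabelsLicenceGenuineK` (p454529: the tame genuine reading); abc-iut-D1-prv's genuine-datum boundary decision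
`Cor312Prov.licence_settingPrVolSharp_pilotDataOfK_iff_of_boundary` (`Cor312LicenceTameBoundaryGenuineK`, p456609: at a genuine datum whose
bad fibres are torsion-free sub-wild — `p > 2`, one index `e_p ≤ p − 1`, no non-trivial `p`-th root of unity in `K_x` — the licence is
abc-iut-w5-d009's exact integer predicate in the q-degree `P_w ∈ ℕ`); abc-iut-w6-d060's `TorsionFree.logUnits_eq_closedBall_of_le_pred`
(`log_p 𝒪_x^× = 𝔪_x` there); abc-iut-S7's `exists_isUniformizer_rescaledCompletion`; abc-iut-w5-d236's `norm_qIdele_eq_rpow_of_realises` /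
`norm_qIdele_le_one_of_realises`; abc-iut-w5-d009's `tame_exact_of_sufficient_leg` / `necessary_leg_of_tame_exact` /
`exists_qPinned_and_hull_settingPrVolSharp_iff_licence`.
CONTENT (namespace `Summit.ABC.IUTFork.Repair.CandInternal2RealLabelsLicenceBallGenuineK`):
* `mem_pow_smul_logShell_qIdele_pilotDataOfK_iff_of_torsionFree` — at a torsion-free sub-wild bad place of the genuine datum, for the REALISING
  q-idele (`P_q(w) = P ∈ ℕ`): `t_{q,w} ∈ t_{q,w}^{N} · ℐ_{K_w} ⟺ (N − 1)·P ≤ e_p − 1` (part 2's tame iff with `e_p ≤ p − 2` widened to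
  `e_p ≤ p − 1 ∧ ζ_p ∉ K_w`);
* **`licence_settingPrVolSharp_pilotDataOfK_of_realStar_torsionFree`** — «real I06⋆ cell at every bad place and label» ⟹ the (xi-f) licence at
  `settingPrVolSharp (pilotDataOfK D K) …`;
* **`exists_qPinned_and_hull_settingPrVolSharp_pilotDataOfK_of_realStar_torsionFree`** — … ⟹ branch C's per-datum S_H antecedent
  «∃ ρ qK, QPinned ∧ PilotKummerCompatHull» (any columns `col`);
* `realLinear_of_licence_settingPrVolSharp_pilotDataOfK_torsionFree` — conversely the licence ⟹ the LINEAR shell cells `t_{q,w} ∈ t_{q,w}^{j}·ℐ_{K_w}`.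
READING (START-HERE v1.1 §1–§3, ROUND1 row 5 «tame-band-licence»; neutral): the genuine-datum rows of the I06⋆ column block on the strata
`tame` and `boundary ∧ zeta_p_in_Kw = 0` carry the same three nested per-cell predicates QUADRATIC `(j²−1)·P_w ≤ e_p−1` (= I06⋆ cell) ⟹ LICENCE
⟹ LINEAR `(j−1)·P_w ≤ e_p−1`, and on those rows «I06⋆ POS ⟹ S_H antecedent INHABITED» is a kernel theorem at the datum; the genuinely open cells
are the non-ball ones (deep `w`, or `ζ_p ∈ K_w`). HONEST SCOPE (binding, D1-prv's / w5-d009's): OUR sharp containers (Θ-regions constant in `m`),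
Dupuy–Hilado's typed (Ind1)/(Ind2) per (capsule slot, place); the hull-level licence is a STRONGER-THAN-PRINT form of Step (xi-f); nothing about the
printed GLOBAL inequality or the NUMBER-level corollary `Cor22.Cor312AtDatum`; nothing asserts or refutes [IUTchIII] Cor. 3.12.
[cite: Mochizuki2012, IUTchI Def. 3.1 (b),(c) pp. 61–62, Ex. 3.2 (iv) p. 71; IUTchIII Cor. 3.12 p. 173–174, Step (xi-f) p. 184; IUTchIV Prop. 1.2 (i)(ii) p. 10]
[cite: MochizukiAbsTopIII2015, Def 5.4 (iii) p. 126] [cite: NeukirchANT1999, Ch. II Prop. (5.5)–(5.7), (6.8)] [cite: DupuyHilado2025, §3.3, §3.4, §3.9, §4.9]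
[cite: ScholzeStix2018, §2.2 pp. 9–10] [claim: Mochizuki2012, status: disputed] for every IUT sentence quoted. Axioms: standard.
-/

noncomputable section

open Set Metric Function NumberField IsDedekindDomain
open scoped Pointwise

namespace Summit.ABC.IUTFork.Repair.CandInternal2RealLabelsLicenceBallGenuineK

open Literature.AnabelianGeometry.AbsoluteAnabelian Literature.IUT.LogThetaLattice Literature.IUT.LogVolume
  Literature.IUT.HodgeTheaters Literature.NumberTheory.NumberFields Literature.NumberTheory.GaloisRepresentations.Ultrametric
open Summit.ABC.IUTFork.Thm311 Summit.ABC.IUTFork.Thm311.Real Summit.ABC.IUTFork.Cor312 Summit.ABC.IUTFork.Cor312.Setting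
  Summit.ABC.IUTFork.Cor312Vol Summit.ABC.IUTFork.Cor312Prov Summit.ABC.IUTFork.Repair.CandInternal2RealLabels
  Summit.ABC.IUTFork.Repair.CandInternal2RealLabelsLicence Summit.ABC.IUTFork.Repair.CandInternal2RealLabelsLicenceBall

variable {F K Fbar : Type} [Field F] [NumberField F] [Field K] [NumberField K] [Algebra F K] [Field Fbar]
  [Algebra F Fbar] [Algebra K Fbar] {E : WeierstrassCurve F} [E.IsElliptic] {l : ℕ} {Pb : BadPlacePredicates K}
  (D : InitialThetaData F K Fbar E l Pb) {logv : PadicLogs K} (hlog : LogvAnalytic logv)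
  (M : Type) [Field M] [NumberField M]
  (archPk : ∀ (j : (thetaIndex (pilotDataOfK D K)).Label) (vQ : (thetaIndex (pilotDataOfK D K)).VQ),
    Set ((logShellsDH (pilotDataOfK D K) logv).Packet j vQ))
  (archSub : ∀ (j : (thetaIndex (pilotDataOfK D K)).Label) (v : (thetaIndex (pilotDataOfK D K)).V),
    Set ((logShellsDH (pilotDataOfK D K) logv).Packet j ((thetaIndex (pilotDataOfK D K)).over v)))
  (Ψ : ℤ → ∀ v : (thetaIndex (pilotDataOfK D K)).V, v ∈ (thetaIndex (pilotDataOfK D K)).Vbad →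
    Set ((logShellsDH (pilotDataOfK D K) logv).StarPacket v))
  (act : ℤ → ∀ v : (thetaIndex (pilotDataOfK D K)).V, v ∈ (thetaIndex (pilotDataOfK D K)).Vbad →
    (logShellsDH (pilotDataOfK D K) logv).StarPacket v → Module.End ℚ ((logShellsDH (pilotDataOfK D K) logv).StarPacket v))
  (Mmod : ℤ → ∀ j : (thetaIndex (pilotDataOfK D K)).LabelStar, Set ((logShellsDH (pilotDataOfK D K) logv).GlobalPacket j.1))
  (region : ℤ → ∀ j : (thetaIndex (pilotDataOfK D K)).LabelStar, FinDivisor M → ∀ vQ : (thetaIndex (pilotDataOfK D K)).VQ,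
    Set ((logShellsDH (pilotDataOfK D K) logv).Packet j.1 vQ))
  (n : ℤ) {HT : Type} {LogLink : HT → HT → Type} {IsFull : ∀ {s t : HT}, LogLink s t → Prop}
  (lat : LGPGaussianLogThetaLattice LogLink IsFull)
  {Frd : Type} {IsoF : Frd → Frd → Type} {Ob : Frd → Type} {realify : Frd → Frd} {Strip : Type}
  {IsoS : Strip → Strip → Type} {Mv : ∀ v : (thetaIndex (pilotDataOfK D K)).V, v ∈ (thetaIndex (pilotDataOfK D K)).Vbad → Type}
  [∀ v h, Monoid (Mv v h)]
  (sig : GlobalLGPFrobenioidSignature (thetaIndex (pilotDataOfK D K)).lstar (thetaIndex (pilotDataOfK D K)).V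
    (· ∈ (thetaIndex (pilotDataOfK D K)).Vbad) Frd IsoF Ob realify Strip IsoS Mv)
  (split : SplittingMonoids Mv) {ObΔ : Type} {N : ∀ v : (thetaIndex (pilotDataOfK D K)).V, v ∈ (thetaIndex (pilotDataOfK D K)).Vbad → Type}
  [∀ v h, Monoid (N v h)] (qData : QPilotData ObΔ N)
  (tq : ∀ (pp : Nat.Primes) (x : (thetaIndex (pilotDataOfK D K)).Fibre (.inr pp)),
    haveI : Fact (pp : ℕ).Prime := ⟨pp.2⟩; kOf (pilotDataOfK D K) pp.1 x)
  (t : ∀ (pp : Nat.Primes) (_ : Fin (pilotDataOfK D K).lstar) (x : (thetaIndex (pilotDataOfK D K)).Fibre (.inr pp)),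
    haveI : Fact (pp : ℕ).Prime := ⟨pp.2⟩; kOf (pilotDataOfK D K) pp.1 x)
  (htq0 : ∀ pp x, tq pp x ≠ 0)
  (htq1 : ∀ (pp : Nat.Primes) (x : (thetaIndex (pilotDataOfK D K)).Fibre (.inr pp)),
    haveI : Fact (pp : ℕ).Prime := ⟨pp.2⟩; placeOf (pilotDataOfK D K) pp.1 x ∉ (pilotDataOfK D K).S → ‖tq pp x‖ = 1)
  (col : ℤ → Column (logShellsDH (pilotDataOfK D K) logv))
  (ht0 : ∀ pp i x, t pp i x ≠ 0)
  (ht : ∀ (pp : Nat.Primes) (i : Fin (pilotDataOfK D K).lstar) (x : (thetaIndex (pilotDataOfK D K)).Fibre (.inr pp)),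
    haveI : Fact (pp : ℕ).Prime := ⟨pp.2⟩
    Real.log ‖t pp i x‖ = -((pilotDataOfK D K).thetaPilot i (placeOf (pilotDataOfK D K) pp.1 x)) *
      logNorm K (placeOf (pilotDataOfK D K) pp.1 x) / localDegree K (placeOf (pilotDataOfK D K) pp.1 x))
  (htq : ∀ (pp : Nat.Primes) (x : (thetaIndex (pilotDataOfK D K)).Fibre (.inr pp)),
    haveI : Fact (pp : ℕ).Prime := ⟨pp.2⟩
    Real.log ‖tq pp x‖ = -((pilotDataOfK D K).qPilot (placeOf (pilotDataOfK D K) pp.1 x)) *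
      logNorm K (placeOf (pilotDataOfK D K) pp.1 x) / localDegree K (placeOf (pilotDataOfK D K) pp.1 x))

include htq0 htq in
/-- **The real I06⋆-type cell of the REALISING q-idele at a TORSION-FREE SUB-WILD bad place of the genuine datum, integer currency**: `p > 2`,
`e(w|p) = e ≤ p − 1`, no non-trivial `p`-th root of unity in `K_w` (so `log_p 𝒪^×_{K_w} = 𝔪` by abc-iut-w6-d060), `P_q(w) = P ∈ ℕ`
(`‖t_{q,w}‖ = p^{−P/e}`): `t_{q,w} ∈ t_{q,w}^{N} · ℐ_{K_w} ⟺ (N − 1)·P ≤ e − 1` (part 3 §1). [cite: NeukirchANT1999, Ch. II Prop. (5.5)–(5.7), (6.8)]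
[cite: DupuyHilado2025, §3.4] [cite: MochizukiAbsTopIII2015, Def 5.4 (iii) p. 126] [claim: Mochizuki2012, status: disputed] -/
theorem mem_pow_smul_logShell_qIdele_pilotDataOfK_iff_of_torsionFree (pp : Nat.Primes)
    (w : (thetaIndex (pilotDataOfK D K)).Fibre (.inr pp)) (hp2 : 2 < (pp : ℕ)) {e : ℕ} (hep : e ≤ (pp : ℕ) - 1)
    (hram : haveI : Fact (pp : ℕ).Prime := ⟨pp.2⟩; (placeOf (pilotDataOfK D K) pp.1 w).asIdeal.ramificationIdx ℤ = e)
    (hμ : haveI : Fact (pp : ℕ).Prime := ⟨pp.2⟩; ∀ ζ : kOf (pilotDataOfK D K) pp.1 w, ζ ^ (pp : ℕ) = 1 → ζ = 1)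
    {P : ℕ} (hP : haveI : Fact (pp : ℕ).Prime := ⟨pp.2⟩; (pilotDataOfK D K).qPilot (placeOf (pilotDataOfK D K) pp.1 w) = P) (N : ℕ) :
    haveI : Fact (pp : ℕ).Prime := ⟨pp.2⟩
    tq pp w ∈ tq pp w ^ N • logShell (PadicLogOnUnits.ofUnitLog (pp : ℕ) (kOf (pilotDataOfK D K) pp.1 w)) ↔
      ((N : ℤ) - 1) * (P : ℤ) ≤ (e : ℤ) - 1 := by
  haveI hF : Fact (pp : ℕ).Prime := ⟨pp.2⟩
  obtain ⟨ϖ, hϖ, hϖnorm⟩ := exists_isUniformizer_rescaledCompletion K (pp : ℕ) (placeOf (pilotDataOfK D K) pp.1 w)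
    (natCast_mem_placeOf (pilotDataOfK D K) pp.1 w)
  have heK : absRamificationIdx (pp : ℕ) (kOf (pilotDataOfK D K) pp.1 w) = e :=
    (absRamificationIdx_rescaledCompletion K (pp : ℕ) (placeOf (pilotDataOfK D K) pp.1 w)
      (natCast_mem_placeOf (pilotDataOfK D K) pp.1 w)).trans hram
  have hΛ : logUnits (kOf (pilotDataOfK D K) pp.1 w) =
      closedBall (0 : kOf (pilotDataOfK D K) pp.1 w) ‖(ϖ : kOf (pilotDataOfK D K) pp.1 w)‖ :=
    TorsionFree.logUnits_eq_closedBall_of_le_pred (pp : ℕ) hϖ hμ (by omega) (heK.le.trans hep)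
  -- the realising norm as a power of the uniformizer: `‖t_q‖ = p^{−P/e} = ‖ϖ‖^P`
  have hp0 : (0 : ℝ) < (pp : ℕ) := by exact_mod_cast pp.2.pos
  have hqm : ‖tq pp w‖ = ‖(ϖ : kOf (pilotDataOfK D K) pp.1 w)‖ ^ (P : ℤ) := by
    rw [norm_qIdele_eq_rpow_of_realises (pilotDataOfK D K) tq htq0 htq pp w, hP, ramIdx_eq K (placeOf (pilotDataOfK D K) pp.1 w),
      zpow_natCast, hϖnorm, ← Real.rpow_natCast, ← Real.rpow_mul hp0.le]
    congr 1
    ring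
  rw [mem_pow_smul_logShell_iff_int_of_ball (pp : ℕ) (kOf (pilotDataOfK D K) pp.1 w) (Nat.ne_of_gt hp2) hϖ hΛ (htq0 pp w) hqm N, heK]

include ht0 ht htq in
/-- **THE (xi-f) LICENCE AT THE GENUINE `K`-LEVEL DATUM FROM THE REAL I06⋆ CELLS, torsion-free sub-wild bad fibres** (REALISING ideles). If
every place `x` of `K` over a prime `p` below a bad place has `p > 2`, the same index `e(x|p) = e_p ≤ p − 1` and no non-trivial `p`-th root of
unity in `K_x`, and at every bad place `w | p` and every label `j = i+1 ∈ 𝔽_l^⋇` the q-idele lies in the `j²`-power orbit of the real log-shell,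
`t_{q,w} ∈ t_{q,w}^{j²} · ℐ_{K_w}` (the REAL I06⋆ cell), THEN abc-iut-c312-1's `Thm311ToCor312.Licence` holds at `settingPrVolSharp (pilotDataOfK D K) …`
(cell ⟹ `(j²−1)·P_w ≤ e_p − 1` ⟹ abc-iut-w5-d009's sufficient leg ⟹ abc-iut-D1-prv's `licence_settingPrVolSharp_pilotDataOfK_iff_of_boundary`).
[cite: Mochizuki2012, IUTchI Ex. 3.2 (iv) p. 71; IUTchIV Prop. 1.2 (i)(ii) p. 10] [cite: DupuyHilado2025, §3.3, §3.4, §4.9]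
[cite: NeukirchANT1999, Ch. II Prop. (5.5)–(5.7)] [claim: Mochizuki2012, status: disputed] -/
theorem licence_settingPrVolSharp_pilotDataOfK_of_realStar_torsionFree (e : Nat.Primes → ℕ)
    (hbdry : ∀ (pp : Nat.Primes) (x : (thetaIndex (pilotDataOfK D K)).Fibre (.inr pp)),
      haveI : Fact (pp : ℕ).Prime := ⟨pp.2⟩
      (∃ w : (thetaIndex (pilotDataOfK D K)).Fibre (.inr pp), placeOf (pilotDataOfK D K) pp.1 w ∈ (pilotDataOfK D K).S) →
        2 < (pp : ℕ) ∧ e pp ≤ (pp : ℕ) - 1 ∧ (placeOf (pilotDataOfK D K) pp.1 x).asIdeal.ramificationIdx ℤ = e pp ∧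
          ∀ ζ : kOf (pilotDataOfK D K) pp.1 x, ζ ^ (pp : ℕ) = 1 → ζ = 1)
    (hstar : ∀ (pp : Nat.Primes) (i : Fin (pilotDataOfK D K).lstar) (w : (thetaIndex (pilotDataOfK D K)).Fibre (.inr pp)),
      haveI : Fact (pp : ℕ).Prime := ⟨pp.2⟩
      placeOf (pilotDataOfK D K) pp.1 w ∈ (pilotDataOfK D K).S →
        tq pp w ∈ tq pp w ^ (((i : ℕ) + 1) ^ 2) • logShell (PadicLogOnUnits.ofUnitLog (pp : ℕ) (kOf (pilotDataOfK D K) pp.1 w))) :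
    Thm311ToCor312.Licence
      (settingPrVolSharp (pilotDataOfK D K) hlog M archPk archSub Ψ act Mmod region n lat sig split qData tq t htq0 htq1) := by
  refine (licence_settingPrVolSharp_pilotDataOfK_iff_of_boundary D hlog M archPk archSub Ψ act Mmod region n lat sig split qData tq t
    htq0 htq1 ht0 ht htq e hbdry).2 fun pp i w hw P hP => ?_
  haveI hF : Fact (pp : ℕ).Prime := ⟨pp.2⟩
  obtain ⟨hp2, hep, hram, hμ⟩ := hbdry pp w ⟨w, hw⟩
  have he1 : (1 : ℤ) ≤ e pp := by
    have h0 := absRamificationIdx_pos (pp : ℕ) (kOf (pilotDataOfK D K) pp.1 w)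
    rw [(absRamificationIdx_rescaledCompletion K (pp : ℕ) (placeOf (pilotDataOfK D K) pp.1 w)
      (natCast_mem_placeOf (pilotDataOfK D K) pp.1 w)).trans hram] at h0
    exact_mod_cast h0
  have hle := (mem_pow_smul_logShell_qIdele_pilotDataOfK_iff_of_torsionFree D tq htq0 htq pp w hp2 hep hram hμ hP
    (((i : ℕ) + 1) ^ 2)).1 (hstar pp i w hw)
  have hP0 : (0 : ℤ) ≤ (P : ℤ) := by positivity
  have hsuff : (((i : ℤ) + 1) ^ 2 - 1) * (P : ℤ) ≤ ((i : ℤ) + 1) * ((e pp : ℤ) - 1) := by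
    push_cast at hle
    nlinarith [hle, he1, hP0]
  have hex := tame_exact_of_sufficient_leg (e := (e pp : ℤ)) (j := (i : ℤ) + 1) (L := (i : ℤ) + 1) (P := (P : ℤ)) he1 hP0
    (by omega) le_rfl hsuff
  push_cast
  exact hex

include ht0 ht htq in
/-- **… hence BRANCH C's PER-DATUM S_H ANTECEDENT «∃ ρ qK, QPinned ∧ PilotKummerCompatHull» at the genuine `K`-level datum** (any columns
`col`; realising q-ideles have norm `≤ 1`). The (k2) target shape of plan/rescue/R-H/START-HERE.md §3 reached from the I06⋆ column block on the
torsion-free sub-wild strata (ROUND1 row 5, ball scope). [cite: Mochizuki2012, IUTchI Ex. 3.2 (iv) p. 71; IUTchIII Step (xi) (xi-f) p. 184]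
[cite: DupuyHilado2025, §3.3, §3.4, §4.9] [claim: Mochizuki2012, status: disputed] -/
theorem exists_qPinned_and_hull_settingPrVolSharp_pilotDataOfK_of_realStar_torsionFree (e : Nat.Primes → ℕ)
    (hbdry : ∀ (pp : Nat.Primes) (x : (thetaIndex (pilotDataOfK D K)).Fibre (.inr pp)),
      haveI : Fact (pp : ℕ).Prime := ⟨pp.2⟩
      (∃ w : (thetaIndex (pilotDataOfK D K)).Fibre (.inr pp), placeOf (pilotDataOfK D K) pp.1 w ∈ (pilotDataOfK D K).S) →
        2 < (pp : ℕ) ∧ e pp ≤ (pp : ℕ) - 1 ∧ (placeOf (pilotDataOfK D K) pp.1 x).asIdeal.ramificationIdx ℤ = e pp ∧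
          ∀ ζ : kOf (pilotDataOfK D K) pp.1 x, ζ ^ (pp : ℕ) = 1 → ζ = 1)
    (hstar : ∀ (pp : Nat.Primes) (i : Fin (pilotDataOfK D K).lstar) (w : (thetaIndex (pilotDataOfK D K)).Fibre (.inr pp)),
      haveI : Fact (pp : ℕ).Prime := ⟨pp.2⟩
      placeOf (pilotDataOfK D K) pp.1 w ∈ (pilotDataOfK D K).S →
        tq pp w ∈ tq pp w ^ (((i : ℕ) + 1) ^ 2) • logShell (PadicLogOnUnits.ofUnitLog (pp : ℕ) (kOf (pilotDataOfK D K) pp.1 w))) :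
    ∃ (ρ : (∀ v : (thetaIndex (pilotDataOfK D K)).V, v ∈ (thetaIndex (pilotDataOfK D K)).Vbad →
            Set ((logShellsDH (pilotDataOfK D K) logv).StarPacket v)) →
          ∀ (j : (thetaIndex (pilotDataOfK D K)).Label) (vQ : (thetaIndex (pilotDataOfK D K)).VQ),
            Set ((logShellsDH (pilotDataOfK D K) logv).Packet j vQ))
        (qK : ∀ v : (thetaIndex (pilotDataOfK D K)).V, v ∈ (thetaIndex (pilotDataOfK D K)).Vbad →
          Set ((logShellsDH (pilotDataOfK D K) logv).StarPacket v)),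
        QPinned ({ toSituation := situationPrVol (pilotDataOfK D K) hlog M archPk archSub Ψ act Mmod region, col := col } :
            LatticeSituation (thetaIndex (pilotDataOfK D K)))
          (settingPrVolSharp (pilotDataOfK D K) hlog M archPk archSub Ψ act Mmod region n lat sig split qData tq t htq0 htq1) ρ qK ∧
        PilotKummerCompatHull ({ toSituation := situationPrVol (pilotDataOfK D K) hlog M archPk archSub Ψ act Mmod region, col := col } :
            LatticeSituation (thetaIndex (pilotDataOfK D K)))
          (settingPrVolSharp (pilotDataOfK D K) hlog M archPk archSub Ψ act Mmod region n lat sig split qData tq t htq0 htq1) ρ qK :=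
  (exists_qPinned_and_hull_settingPrVolSharp_iff_licence (pilotDataOfK D K) hlog M archPk archSub Ψ act Mmod region n lat sig split qData
      tq t htq0 htq1 col (fun pp x => norm_qIdele_le_one_of_realises (pilotDataOfK D K) tq htq0 htq pp x)).2
    (licence_settingPrVolSharp_pilotDataOfK_of_realStar_torsionFree D hlog M archPk archSub Ψ act Mmod region n lat sig split qData tq t
      htq0 htq1 ht0 ht htq e hbdry hstar)

include ht0 ht htq in
/-- **CONVERSELY THE LICENCE AT THE GENUINE DATUM FORCES THE LINEAR SHELL CELLS** on torsion-free sub-wild bad fibres: `Thm311ToCor312.Licence`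
at `settingPrVolSharp (pilotDataOfK D K) …` ⟹ `t_{q,w} ∈ t_{q,w}^{j} · ℐ_{K_w}` at every bad place `w` and label `j = i+1` (abc-iut-w5-d009's
necessary leg `(j−1)·P_w ≤ e_p − 1`). [cite: DupuyHilado2025, §3.3, §3.4, §4.9] [cite: NeukirchANT1999, Ch. II Prop. (5.5)–(5.7)]
[claim: Mochizuki2012, status: disputed] -/
theorem realLinear_of_licence_settingPrVolSharp_pilotDataOfK_torsionFree (e : Nat.Primes → ℕ)
    (hbdry : ∀ (pp : Nat.Primes) (x : (thetaIndex (pilotDataOfK D K)).Fibre (.inr pp)),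
      haveI : Fact (pp : ℕ).Prime := ⟨pp.2⟩
      (∃ w : (thetaIndex (pilotDataOfK D K)).Fibre (.inr pp), placeOf (pilotDataOfK D K) pp.1 w ∈ (pilotDataOfK D K).S) →
        2 < (pp : ℕ) ∧ e pp ≤ (pp : ℕ) - 1 ∧ (placeOf (pilotDataOfK D K) pp.1 x).asIdeal.ramificationIdx ℤ = e pp ∧
          ∀ ζ : kOf (pilotDataOfK D K) pp.1 x, ζ ^ (pp : ℕ) = 1 → ζ = 1)
    (hL : Thm311ToCor312.Licence
      (settingPrVolSharp (pilotDataOfK D K) hlog M archPk archSub Ψ act Mmod region n lat sig split qData tq t htq0 htq1)) :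
    ∀ (pp : Nat.Primes) (i : Fin (pilotDataOfK D K).lstar) (w : (thetaIndex (pilotDataOfK D K)).Fibre (.inr pp)),
      haveI : Fact (pp : ℕ).Prime := ⟨pp.2⟩
      placeOf (pilotDataOfK D K) pp.1 w ∈ (pilotDataOfK D K).S →
        tq pp w ∈ tq pp w ^ ((i : ℕ) + 1) • logShell (PadicLogOnUnits.ofUnitLog (pp : ℕ) (kOf (pilotDataOfK D K) pp.1 w)) := by
  intro pp i w hw
  haveI hF : Fact (pp : ℕ).Prime := ⟨pp.2⟩
  obtain ⟨hp2, hep, hram, hμ⟩ := hbdry pp w ⟨w, hw⟩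
  obtain ⟨P, hPspec⟩ := exists_nat_qPilot_pilotDataOfK D hw
  have hP := hPspec.1
  have hall := (licence_settingPrVolSharp_pilotDataOfK_iff_of_boundary D hlog M archPk archSub Ψ act Mmod region n lat sig split qData tq
    t htq0 htq1 ht0 ht htq e hbdry).1 hL pp i w hw P hP
  have he1 : (1 : ℤ) ≤ e pp := by
    have h0 := absRamificationIdx_pos (pp : ℕ) (kOf (pilotDataOfK D K) pp.1 w)
    rw [(absRamificationIdx_rescaledCompletion K (pp : ℕ) (placeOf (pilotDataOfK D K) pp.1 w)
      (natCast_mem_placeOf (pilotDataOfK D K) pp.1 w)).trans hram] at h0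
    exact_mod_cast h0
  have hex : (e pp : ℤ) * ((((i : ℤ) + 1) ^ 2 * (P : ℤ) - 1) / e pp) + 1 - ((i : ℤ) + 1) * ((e pp : ℤ) - 1) ≤ (P : ℤ) := by
    push_cast at hall
    exact hall
  have hnec := necessary_leg_of_tame_exact (e := (e pp : ℤ)) (L := (i : ℤ) + 1) (P := (P : ℤ)) he1 (by omega) hex
  refine (mem_pow_smul_logShell_qIdele_pilotDataOfK_iff_of_torsionFree D tq htq0 htq pp w hp2 hep hram hμ hP ((i : ℕ) + 1)).2 ?_
  push_cast
  linarith

end Summit.ABC.IUTFork.Repair.CandInternal2RealLabelsLicenceBallGenuineK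

end
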